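import Mathlib.AlgebraicGeometry.Morphisms.FormallyUnramified
import Mathlib.AlgebraicGeometry.Morphisms.Separated
import Mathlib.AlgebraicGeometry.Morphisms.ClosedImmersion
import Mathlib.AlgebraicGeometry.Morphisms.Etale
import Mathlib.AlgebraicGeometry.Morphisms.Finite
import HarnessLib

/-!
# The equaliser of two sections of an unramified separated morphism is open and closed

Topic `Literature/AlgebraicGeometry/Morphisms`; theorems only (no definition, no named fact, no
instance). For `q : G ⟶ S` and two sections `σ, τ : S ⟶ G` of `q`, the equaliser `Eq(σ, τ)` is
the pullback of the diagonal `Δ_q : G ⟶ G ×_S G` along `(σ, τ) : S ⟶ G ×_S G`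
([GortzWedhorn2020] Prop. 9.3, Prop. 9.5); it is a CLOSED subscheme when `q` is separated
([GortzWedhorn2020] Def./Prop. 9.7) and an OPEN subscheme when `q` is unramified, the diagonal of
an unramified morphism being an open immersion ([GortzWedhorn2023] Remark 18.30; Mathlib
`isOpenImmersion_diagonal`). Hence for `q` unramified and separated — e.g. a finite étale group
scheme `G → S` — the locus where `σ = τ` is an open-and-closed subscheme of `S`, and a test
morphism `x : T ⟶ S` satisfies `x ≫ σ = x ≫ τ` iff it lands in it. For finitely many pairs
`(σᵢ, τᵢ)` the complementary locus «`σᵢ ≠ τᵢ` for all `i`» is again clopen; the frame cover of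
level structures (`AbelianSchemes/TorsionFrameCover`) restricts to it.

* `isOpenImmersion_sectionEqualizer`, `isClosedImmersion_sectionEqualizer`,
  `isClopen_range_sectionEqualizer`;
* `comp_eq_comp_iff_range_subset_sectionEqualizer` — `x ≫ σ = x ≫ τ ↔ range x ⊆ Eq(σ, τ)`;
* `isClopen_sectionNeLocus`, `comp_ne_comp_of_range_subset_sectionNeLocus`,
  `range_subset_sectionNeLocus_of_comp_ne_comp` — the finite «`σᵢ ≠ τᵢ`» locus.

## References
* [GortzWedhorn2020] U. Görtz, T. Wedhorn, *Algebraic Geometry I*, 2nd ed., Prop. 9.3 and Prop. 9.5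
  (equalisers via the diagonal), Def./Prop. 9.7 and Cor. 9.9 (separated ⇒ `Eq(f,g)` closed),
  Example 9.12 (sections of a separated morphism are closed immersions).
* [GortzWedhorn2023] U. Görtz, T. Wedhorn, *Algebraic Geometry II*, Remark 18.30 with Prop. 18.29
  (the diagonal of an unramified morphism is an open immersion).
-/

noncomputable section

open CategoryTheory CategoryTheory.Limits AlgebraicGeometry

universe u

namespace Literature.AlgebraicGeometry.Morphisms

variable {G S : Scheme.{u}} {q : G ⟶ S} {σ τ : S ⟶ G}

/-! ## §1 One pair of sections

Throughout, `w : σ ≫ q = τ ≫ q` (for two sections of `q` both sides are `𝟙 S`); the equaliser is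
`pullback.snd (pullback.diagonal q) (pullback.lift σ τ w) : Eq(σ, τ) ⟶ S`. -/

/-- The equaliser of `σ, τ` over `q` lies over both: `Eq(σ,τ) → S → G` agrees for `σ` and `τ`.
[cite: GortzWedhorn2020, Prop. 9.3] -/
theorem sectionEqualizer_comp_eq (w : σ ≫ q = τ ≫ q) :
    pullback.snd (pullback.diagonal q) (pullback.lift σ τ w) ≫ σ =
      pullback.snd (pullback.diagonal q) (pullback.lift σ τ w) ≫ τ := by
  have h := pullback.condition (f := pullback.diagonal q) (g := pullback.lift σ τ w)
  have h₁ := congrArg (· ≫ pullback.fst q q) h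
  have h₂ := congrArg (· ≫ pullback.snd q q) h
  simp only [Category.assoc, pullback.diagonal_fst, pullback.diagonal_snd, Category.comp_id,
    pullback.lift_fst, pullback.lift_snd] at h₁ h₂
  rw [← h₁, ← h₂]

/-- **The equaliser of two morphisms into an UNRAMIFIED scheme is open**: the diagonal of an
unramified morphism locally of finite type is an open immersion (Mathlib
`isOpenImmersion_diagonal`), and `Eq(σ,τ) → S` is its base change.
[cite: GortzWedhorn2023, Remark 18.30 and Prop. 18.29] [cite: GortzWedhorn2020, Prop. 9.3] -/
theorem isOpenImmersion_sectionEqualizer [FormallyUnramified q] [LocallyOfFiniteType q]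
    (w : σ ≫ q = τ ≫ q) :
    IsOpenImmersion (pullback.snd (pullback.diagonal q) (pullback.lift σ τ w)) :=
  inferInstance

/-- **The equaliser of two morphisms into a SEPARATED scheme is closed**: the diagonal of a
separated morphism is a closed immersion, and `Eq(σ,τ) → S` is its base change.
[cite: GortzWedhorn2020, Def./Prop. 9.7 and Cor. 9.9] -/
theorem isClosedImmersion_sectionEqualizer [IsSeparated q] (w : σ ≫ q = τ ≫ q) :
    IsClosedImmersion (pullback.snd (pullback.diagonal q) (pullback.lift σ τ w)) :=
  MorphismProperty.pullback_snd (P := @IsClosedImmersion) _ _ inferInstance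

/-- **The locus `σ = τ` is open and closed** when the target is unramified (locally of finite type)
and separated over `S` — e.g. two sections of a finite étale group scheme.
[cite: GortzWedhorn2023, Remark 18.30 and Prop. 18.29] [cite: GortzWedhorn2020, Def./Prop. 9.7] -/
theorem isClopen_range_sectionEqualizer [FormallyUnramified q] [LocallyOfFiniteType q]
    [IsSeparated q] (w : σ ≫ q = τ ≫ q) :
    IsClopen (Set.range (pullback.snd (pullback.diagonal q) (pullback.lift σ τ w))) := by
  haveI := isClosedImmersion_sectionEqualizer (q := q) w
  exact ⟨(pullback.snd (pullback.diagonal q) (pullback.lift σ τ w)).isClosedEmbedding.isClosed_range,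
    (pullback.snd (pullback.diagonal q) (pullback.lift σ τ w)).isOpenEmbedding.isOpen_range⟩

/-- **Universal property of the equaliser on test morphisms**: for `x : T ⟶ S`,
`x ≫ σ = x ≫ τ` iff `x` lands in the (open) equaliser `Eq(σ,τ) ⊆ S`.
[cite: GortzWedhorn2020, Prop. 9.3 and Prop. 9.5] -/
theorem comp_eq_comp_iff_range_subset_sectionEqualizer [FormallyUnramified q]
    [LocallyOfFiniteType q] (w : σ ≫ q = τ ≫ q) {T : Scheme.{u}} (x : T ⟶ S) :
    x ≫ σ = x ≫ τ ↔
      Set.range x ⊆ Set.range (pullback.snd (pullback.diagonal q) (pullback.lift σ τ w)) := by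
  constructor
  · intro hx
    -- `x` factors through the pullback of the diagonal
    have hw : (x ≫ σ) ≫ pullback.diagonal q = x ≫ pullback.lift σ τ w := by
      apply pullback.hom_ext
      · rw [Category.assoc, pullback.diagonal_fst, Category.comp_id, Category.assoc,
          pullback.lift_fst]
      · rw [Category.assoc, pullback.diagonal_snd, Category.comp_id, Category.assoc,
          pullback.lift_snd, hx]
    let y : T ⟶ pullback (pullback.diagonal q) (pullback.lift σ τ w) :=
      pullback.lift (x ≫ σ) x hw
    have hy : y ≫ pullback.snd _ _ = x := pullback.lift_snd _ _ _
    rintro _ ⟨t, rfl⟩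
    exact ⟨y t, by rw [← Scheme.Hom.comp_apply, hy]⟩
  · intro hx
    let y := IsOpenImmersion.lift (pullback.snd (pullback.diagonal q) (pullback.lift σ τ w)) x hx
    have hy : y ≫ pullback.snd _ _ = x := IsOpenImmersion.lift_fac _ _ _
    rw [← hy, Category.assoc, Category.assoc, sectionEqualizer_comp_eq w]

/-- Pointwise form for a ONE-POINT test scheme (e.g. `T = Spec Ω`, `Ω` a field): `x ≫ σ = x ≫ τ`
iff the image point lies in the equaliser. [folklore] -/
private theorem comp_eq_comp_iff_mem_of_subsingleton [FormallyUnramified q] [LocallyOfFiniteType q]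
    (w : σ ≫ q = τ ≫ q) {T : Scheme.{u}} [Subsingleton T] (x : T ⟶ S) (t : T) :
    x ≫ σ = x ≫ τ ↔
      x t ∈ Set.range (pullback.snd (pullback.diagonal q) (pullback.lift σ τ w)) := by
  rw [comp_eq_comp_iff_range_subset_sectionEqualizer w]
  constructor
  · exact fun h => h ⟨t, rfl⟩
  · rintro h _ ⟨t', rfl⟩
    rwa [Subsingleton.elim t' t]

/-! ## §2 Finitely many pairs: the locus «`σᵢ ≠ τᵢ` for all `i`» -/

variable {ι : Type*} [Finite ι] {σs τs : ι → (S ⟶ G)}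

/-- **The locus where finitely many pairs of sections all DIFFER is open and closed** (a finite
intersection of complements of clopen equalisers). [cite: GortzWedhorn2020, Def./Prop. 9.7]
[cite: GortzWedhorn2023, Remark 18.30 and Prop. 18.29] -/
theorem isClopen_sectionNeLocus [FormallyUnramified q] [LocallyOfFiniteType q] [IsSeparated q]
    (w : ∀ i, σs i ≫ q = τs i ≫ q) :
    IsClopen (⋂ i, (Set.range
      (pullback.snd (pullback.diagonal q) (pullback.lift (σs i) (τs i) (w i))))ᶜ) :=
  isClopen_iInter_of_finite fun i => (isClopen_range_sectionEqualizer (w i)).compl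

omit [Finite ι] in
/-- A ONE-POINT test morphism landing in the «all differ» locus separates every pair:
`x ≫ σᵢ ≠ x ≫ τᵢ`. [cite: GortzWedhorn2020, Prop. 9.3 and Prop. 9.5] -/
theorem comp_ne_comp_of_range_subset_sectionNeLocus [FormallyUnramified q]
    [LocallyOfFiniteType q] (w : ∀ i, σs i ≫ q = τs i ≫ q) {T : Scheme.{u}} [Subsingleton T]
    (t : T) (x : T ⟶ S)
    (hx : Set.range x ⊆ ⋂ i, (Set.range
      (pullback.snd (pullback.diagonal q) (pullback.lift (σs i) (τs i) (w i))))ᶜ) (i : ι) :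
    x ≫ σs i ≠ x ≫ τs i := by
  intro h
  have hmem := (comp_eq_comp_iff_mem_of_subsingleton (w i) x t).mp h
  have := Set.mem_iInter.mp (hx ⟨t, rfl⟩) i
  exact this hmem

omit [Finite ι] in
/-- Conversely, a ONE-POINT test morphism separating every pair lands in the «all differ» locus.
[cite: GortzWedhorn2020, Prop. 9.3 and Prop. 9.5] -/
theorem range_subset_sectionNeLocus_of_comp_ne_comp [FormallyUnramified q]
    [LocallyOfFiniteType q] (w : ∀ i, σs i ≫ q = τs i ≫ q) {T : Scheme.{u}} [Subsingleton T]
    (x : T ⟶ S) (hx : ∀ i, x ≫ σs i ≠ x ≫ τs i) :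
    Set.range x ⊆ ⋂ i, (Set.range
      (pullback.snd (pullback.diagonal q) (pullback.lift (σs i) (τs i) (w i))))ᶜ := by
  rintro _ ⟨t, rfl⟩
  refine Set.mem_iInter.mpr fun i hmem => hx i ?_
  exact (comp_eq_comp_iff_mem_of_subsingleton (w i) x t).mpr hmem

/-! ## §3 Restricting to a clopen locus keeps «finite étale» -/

/-- The inclusion of an open subscheme with CLOSED underlying set is a closed immersion, hence
finite (and, being an open immersion, étale). [cite: GortzWedhorn2020, Example 9.12] -/
theorem isClosedImmersion_ι_of_isClosed (U : S.Opens) (hU : IsClosed (U : Set S)) :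
    IsClosedImmersion U.ι :=
  IsClosedImmersion.of_isPreimmersion U.ι (by rwa [Scheme.Opens.range_ι])

/-- A clopen open subscheme is FINITE ÉTALE over the ambient scheme.
[cite: GortzWedhorn2020, Example 9.12] [cite: GortzWedhorn2023, Def. 18.34] -/
theorem isFinite_and_etale_ι_of_isClosed (U : S.Opens) (hU : IsClosed (U : Set S)) :
    IsFinite U.ι ∧ Etale U.ι := by
  haveI := isClosedImmersion_ι_of_isClosed U hU
  exact ⟨inferInstance, inferInstance⟩

end Literature.AlgebraicGeometry.Morphisms
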